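import Summits.HodgeConjecture.HodgeConjecture.Theorems.NikulinTwinTransportSquareTypeTwoTwo
import Literature.AlgebraicGeometry.HodgeTheory.HodgeTypeConjugation

/-!
# Route NikulinTwinTransport · `RealMultiplicationSqrtTwoAlgebraic` (stmt-HodgeConjecture-13679) —
# the canonical class `Υ_G` of a Hodge endomorphism `G` of `H²(S(ℂ); ℂ)` on `S ⊗ S`

First of two files kernel-checking that the route item `RealMultiplicationSqrtTwoAlgebraic` is IMPLIED
by the Hodge conjecture for the fourfold `S ⊗ S` (assembly in the sibling file
`NikulinTwinTransportRealMultiplicationOfHodgeConjecture`). The content is the converse half of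
Varesco's remark "the Hodge conjecture for `X²` is equivalent to showing that every element of
`End_Hdg(T(X))` is algebraic" (Math. Z. 305 (2023), p. 8), i.e. Voisin I, Lemma 11.41 read backwards,
on the tree's carriers: a rational, type-preserving endomorphism `G` of `H²(S(ℂ); ℂ)` is induced, up to
the non-zero fibre-integration constant `c₀` of the orientation family, by a RATIONAL class of Hodge
type `(2,2)` on `S ⊗ S` — the image under `G ⊗ 1` of the canonical element of the (unimodular,
marked) cup form, `Υ_G = Σₖ fst^*(G η⁻¹eₖ) ∪ snd^*(η⁻¹ G⁻¹eₖ)` (`η` a marking of the K3 surface `S`,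
`G⁻¹eₖ` the dual lattice basis):

* `sum_canonical_symm`, `sum_canonical_adjoint`, `sum_canonical_transfer` — linear algebra of the
  canonical element `Ω = Σₖ cₖ ⊗ uₖ` of a symmetric perfect pairing (`Σₖ B(y, uₖ) cₖ = y`): it is
  symmetric, and `(1 ⊗ φ)Ω = (φ† ⊗ 1)Ω` for a `B`-adjoint pair `(φ, φ†)`;
* `isOfHodgeType_sum_cross_projector`, `isOfHodgeType_sum_cross_of_projectors` — if `H²(S(ℂ); ℂ)`
  carries three `B`-compatible idempotents `π₂₀ + π₁₁ + π₀₂ = 1` onto classes of types `(2,0)`,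
  `(1,1)`, `(0,2)` (adjoints `π₂₀† = π₀₂`, `π₁₁† = π₁₁`) and `G` preserves Hodge types, then `Υ_G` is
  of type `(2,2)` on `S ⊗ S` (transfer each projector across the canonical element; types add under
  cross products, `isOfHodgeType_cross`);
* `isOfHodgeType_sum_cross_K3` — the projectors of a marked K3 surface with period `x₀`:
  `π₂₀ x = ((ηx.x̄₀)/(x₀.x̄₀)) σ`, `π₀₂ x = ((ηx.x₀)/(x₀.x̄₀)) σ̄`, `π₁₁ = 1 - π₂₀ - π₀₂`
  (`(x₀.x₀) = 0`, `(x₀.x̄₀) ≠ 0`; Huybrechts Ch. 6 Prop. 1.2 and the K3 Hodge types of `H²`);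
* `isRationalClass_sum_cross` — `Υ_G` is rational (`G` preserves rational classes; the marked basis
  and the dual lattice basis are integral, `Λ_{K3}` being unimodular);
* `corr_sum_cross` — `[Υ_G]_* = c₀ • G` (`corr_cross`: `fst_*(snd^* x ∪ (fst^* v ∪ snd^* u)) = c₀ (x.u) v`,
  and the marked expansion `sum_k3Form_dual_smul_basis`).

Prover seat prover-pitem-stmt-HodgeConjecture-13679-c7-0.

## References

* [Varesco2023] M. Varesco, Hodge similitudes and the Hodge conjecture for squares of K3 surfaces,
  Math. Z. 305 (2023), §2 (p. 8).
* [VoisinHodgeI2002] C. Voisin, Hodge Theory and Complex Algebraic Geometry I, CUP 2002, §11.3.3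
  Lemma 11.41, §7.3.2.
* [Huybrechts2016K3] D. Huybrechts, Lectures on K3 Surfaces, CUP 2016, Ch. 1 Prop. 3.5, Ch. 6 Prop. 1.2,
  Ch. 14 §0.3 (vi).
* [Fulton1998] W. Fulton, Intersection Theory, 2nd ed., Springer 1998, §16.1.
* [FultonYoungTableaux1997] W. Fulton, Young Tableaux, CUP 1997, Appendix B §B.1 (6).
* [HatcherAT2002] A. Hatcher, Algebraic Topology, CUP 2002, §3.1 and §3.2.
-/

noncomputable section

open CategoryTheory AlgebraicGeometry MonoidalCategory CartesianMonoidalCategory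
open Literature.AlgebraicGeometry.Motives Literature.AlgebraicGeometry.HodgeTheory
open Literature.AlgebraicGeometry.Surfaces
open Literature.AlgebraicTopology.SingularHomology

namespace Summit.HodgeConjecture.HodgeConjecture.Theorems.NikulinTwinTransport

/-! ### The canonical element of a symmetric perfect pairing -/

section Canonical

variable {ι V W : Type*} [Fintype ι] [AddCommGroup V] [Module ℂ V] [AddCommGroup W] [Module ℂ W]
  {B : V → V → ℂ} {c u : ι → V}
  (hBs : ∀ a b, B a b = B b a) (hE : ∀ y, ∑ k, B y (u k) • c k = y)

include hBs hE

/-- **The canonical element of a symmetric perfect pairing is symmetric**: if `Σₖ B(y, uₖ) cₖ = y`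
for all `y` (the families `c`, `u` are dual for the symmetric form `B`), then
`Σₖ β(uₖ, cₖ) = Σₖ β(cₖ, uₖ)` for every bilinear `β` (expand `uⱼ = Σₖ B(uⱼ, uₖ) cₖ` and use the
symmetry of `B`). [folklore] -/
theorem sum_canonical_symm (β : V →ₗ[ℂ] V →ₗ[ℂ] W) :
    ∑ k, β (u k) (c k) = ∑ k, β (c k) (u k) := by
  calc ∑ j, β (u j) (c j) = ∑ j, β (∑ k, B (u j) (u k) • c k) (c j) := by simp_rw [hE]
    _ = ∑ j, ∑ k, B (u j) (u k) • β (c k) (c j) := by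
        simp only [map_sum, map_smul, LinearMap.sum_apply, LinearMap.smul_apply]
    _ = ∑ k, ∑ j, B (u k) (u j) • β (c k) (c j) := by
        rw [Finset.sum_comm]
        exact Finset.sum_congr rfl fun k _ ↦ Finset.sum_congr rfl fun j _ ↦ by rw [hBs]
    _ = ∑ k, β (c k) (∑ j, B (u k) (u j) • c j) := by simp only [map_sum, map_smul]
    _ = ∑ k, β (c k) (u k) := by simp_rw [hE]

/-- **Moving an endomorphism across the canonical element**: for a `B`-adjoint pair
`B(φ x, y) = B(x, ψ y)`, `Σₖ β(cₖ, φ uₖ) = Σₖ β(ψ uₖ, cₖ)` (expand `φ uₖ = Σⱼ B(φ uₖ, uⱼ) cⱼ`, move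
`φ` to `ψ`, and resum `Σₖ B(ψ uⱼ, uₖ) cₖ = ψ uⱼ`). [folklore] -/
theorem sum_canonical_adjoint (β : V →ₗ[ℂ] V →ₗ[ℂ] W) (φ ψ : V →ₗ[ℂ] V)
    (hadj : ∀ x y, B (φ x) y = B x (ψ y)) :
    ∑ k, β (c k) (φ (u k)) = ∑ k, β (ψ (u k)) (c k) := by
  calc ∑ k, β (c k) (φ (u k)) = ∑ k, β (c k) (∑ j, B (φ (u k)) (u j) • c j) := by simp_rw [hE]
    _ = ∑ k, ∑ j, B (φ (u k)) (u j) • β (c k) (c j) := by simp only [map_sum, map_smul]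
    _ = ∑ j, ∑ k, B (ψ (u j)) (u k) • β (c k) (c j) := by
        rw [Finset.sum_comm]
        exact Finset.sum_congr rfl fun j _ ↦ Finset.sum_congr rfl fun k _ ↦ by rw [hadj, hBs]
    _ = ∑ j, β (∑ k, B (ψ (u j)) (u k) • c k) (c j) := by
        simp only [map_sum, map_smul, LinearMap.sum_apply, LinearMap.smul_apply]
    _ = ∑ j, β (ψ (u j)) (c j) := by simp_rw [hE]

/-- **Transfer across the canonical element**: for a `B`-adjoint pair `B(φ x, y) = B(x, ψ y)`,
`Σₖ β(cₖ, φ uₖ) = Σₖ β(ψ cₖ, uₖ)` — "`(1 ⊗ φ)Ω = (ψ ⊗ 1)Ω`" for the canonical element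
`Ω = Σₖ cₖ ⊗ uₖ` (`sum_canonical_adjoint` followed by `sum_canonical_symm` for `β(ψ –, –)`). [folklore] -/
theorem sum_canonical_transfer (β : V →ₗ[ℂ] V →ₗ[ℂ] W) (φ ψ : V →ₗ[ℂ] V)
    (hadj : ∀ x y, B (φ x) y = B x (ψ y)) :
    ∑ k, β (c k) (φ (u k)) = ∑ k, β (ψ (c k)) (u k) := by
  rw [sum_canonical_adjoint hBs hE β φ ψ hadj]
  simpa only [LinearMap.comp_apply] using sum_canonical_symm hBs hE (β.comp ψ)

end Canonical

/-! ### The canonical class `Υ_G = Σₖ fst^*(G cₖ) ∪ snd^* uₖ` on `S ⊗ S` is of type `(2,2)` -/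

section TypeTwoTwo

variable {S : SchemeOver ℂ} (hS : IsSmoothProjective 2 S) (M : HodgeModel 4 (S ⊗ S))
  (hcupP : CupPreservesHodgeType 4 (S ⊗ S))
  {ι : Type*} [Fintype ι] {B : complexBetti S (2 * 1) → complexBetti S (2 * 1) → ℂ}
  {c u : ι → complexBetti S (2 * 1)}
  (hBs : ∀ a b, B a b = B b a) (hE : ∀ y, ∑ k, B y (u k) • c k = y)
  (G : complexBetti S (2 * 1) →ₗ[ℂ] complexBetti S (2 * 1))
  (hG : ∀ (i j : ℕ) x, IsOfHodgeType 2 S (2 * 1) i j x → IsOfHodgeType 2 S (2 * 1) i j (G x))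

include hS M hcupP hBs hE hG

/-- **One projector across the canonical class.** For a `B`-adjoint pair `(π, ψ)` with `π`
idempotent, `π` of type `(p, q)` and `ψ` of type `(p', q')`, `p' + p = q' + q = 2`, and `G`
type-preserving: `Σₖ fst^*(G cₖ) ∪ snd^*(π uₖ) = Σₖ fst^*(G ψ cₖ) ∪ snd^*(π uₖ)`
(`sum_canonical_transfer` for `β(a, b) = fst^*(G a) ∪ snd^*(π b)`, `π² = π`) is of type
`(p' + p, q' + q) = (2,2)` on `S ⊗ S` (types add under cross products, `isOfHodgeType_cross`).
[cite: VoisinHodgeI2002, §11.3.3 Lemma 11.41 and §7.3.2] -/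
theorem isOfHodgeType_sum_cross_projector (π ψ : complexBetti S (2 * 1) →ₗ[ℂ] complexBetti S (2 * 1))
    (hadj : ∀ x y, B (π x) y = B x (ψ y)) (hidem : ∀ x, π (π x) = π x) {p q p' q' : ℕ}
    (hπ : ∀ x, IsOfHodgeType 2 S (2 * 1) p q (π x)) (hψ : ∀ x, IsOfHodgeType 2 S (2 * 1) p' q' (ψ x))
    (hp : p' + p = 2) (hq : q' + q = 2) :
    IsOfHodgeType 4 (S ⊗ S) (2 * 2) 2 2
      (∑ k, cupProduct (rfl : 2 * 1 + 2 * 1 = 2 * 2) (complexBetti.map (fst S S) (2 * 1) (G (c k)))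
        (complexBetti.map (snd S S) (2 * 1) (π (u k)))) := by
  have hP : IsSmoothProjective 4 (S ⊗ S) := IsSmoothProjective.tensor_holds hS hS
  -- the bilinear map `β(a, b) = fst^*(G a) ∪ snd^*(π b)`
  let β : complexBetti S (2 * 1) →ₗ[ℂ] complexBetti S (2 * 1) →ₗ[ℂ] complexBetti (S ⊗ S) (2 * 2) :=
    LinearMap.mk₂ ℂ
      (fun a b ↦ cupProduct (rfl : 2 * 1 + 2 * 1 = 2 * 2) (complexBetti.map (fst S S) (2 * 1) (G a))
        (complexBetti.map (snd S S) (2 * 1) (π b)))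
      (fun a a' b ↦ by simp only [map_add, LinearMap.add_apply])
      (fun t a b ↦ by simp only [map_smul, LinearMap.smul_apply])
      (fun a b b' ↦ by simp only [map_add])
      (fun t a b ↦ by simp only [map_smul])
  have hβ : ∀ a b, β a b = cupProduct (rfl : 2 * 1 + 2 * 1 = 2 * 2)
      (complexBetti.map (fst S S) (2 * 1) (G a)) (complexBetti.map (snd S S) (2 * 1) (π b)) :=
    fun a b ↦ rfl
  have key := sum_canonical_transfer hBs hE β π ψ hadj
  have h1 : (∑ k, cupProduct (rfl : 2 * 1 + 2 * 1 = 2 * 2) (complexBetti.map (fst S S) (2 * 1) (G (c k)))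
      (complexBetti.map (snd S S) (2 * 1) (π (u k)))) = ∑ k, β (ψ (c k)) (u k) := by
    rw [← key]
    exact Finset.sum_congr rfl fun k _ ↦ by rw [hβ, hidem]
  rw [h1]
  refine IsOfHodgeType.sum hP M _ _ fun k _ ↦ ?_
  rw [hβ]
  have h := isOfHodgeType_cross hS M hcupP (rfl : 2 * 1 + 2 * 1 = 2 * 2) (hG _ _ _ (hψ (c k))) (hπ (u k))
  rwa [hp, hq] at h

/-- **Three Hodge projectors make the canonical class `(2,2)`.** If `π₂₀ + π₁₁ + π₀₂ = 1` on
`H²(S(ℂ); ℂ)` with `πᵢ` idempotent, `B(π₂₀ x, y) = B(x, π₀₂ y)`, `B(π₁₁ x, y) = B(x, π₁₁ y)`,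
`B(π₀₂ x, y) = B(x, π₂₀ y)`, and `πᵢ x` of type `(2,0)`, `(1,1)`, `(0,2)` respectively, then for `G`
type-preserving `Υ_G = Σₖ fst^*(G cₖ) ∪ snd^* uₖ` is of type `(2,2)` on `S ⊗ S` (split `uₖ` by the
projectors and apply `isOfHodgeType_sum_cross_projector` three times).
[cite: VoisinHodgeI2002, §11.3.3 Lemma 11.41] -/
theorem isOfHodgeType_sum_cross_of_projectors
    (π₁ π₂ π₃ : complexBetti S (2 * 1) →ₗ[ℂ] complexBetti S (2 * 1))
    (hsum : ∀ x, π₁ x + π₂ x + π₃ x = x)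
    (h1 : ∀ x, π₁ (π₁ x) = π₁ x) (h2 : ∀ x, π₂ (π₂ x) = π₂ x) (h3 : ∀ x, π₃ (π₃ x) = π₃ x)
    (hadj₁ : ∀ x y, B (π₁ x) y = B x (π₃ y)) (hadj₂ : ∀ x y, B (π₂ x) y = B x (π₂ y))
    (hadj₃ : ∀ x y, B (π₃ x) y = B x (π₁ y))
    (ht₁ : ∀ x, IsOfHodgeType 2 S (2 * 1) 2 0 (π₁ x)) (ht₂ : ∀ x, IsOfHodgeType 2 S (2 * 1) 1 1 (π₂ x))
    (ht₃ : ∀ x, IsOfHodgeType 2 S (2 * 1) 0 2 (π₃ x)) :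
    IsOfHodgeType 4 (S ⊗ S) (2 * 2) 2 2
      (∑ k, cupProduct (rfl : 2 * 1 + 2 * 1 = 2 * 2) (complexBetti.map (fst S S) (2 * 1) (G (c k)))
        (complexBetti.map (snd S S) (2 * 1) (u k))) := by
  have hP : IsSmoothProjective 4 (S ⊗ S) := IsSmoothProjective.tensor_holds hS hS
  have hsplit : (∑ k, cupProduct (rfl : 2 * 1 + 2 * 1 = 2 * 2)
      (complexBetti.map (fst S S) (2 * 1) (G (c k))) (complexBetti.map (snd S S) (2 * 1) (u k))) =
      (∑ k, cupProduct (rfl : 2 * 1 + 2 * 1 = 2 * 2) (complexBetti.map (fst S S) (2 * 1) (G (c k)))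
        (complexBetti.map (snd S S) (2 * 1) (π₁ (u k)))) +
      (∑ k, cupProduct (rfl : 2 * 1 + 2 * 1 = 2 * 2) (complexBetti.map (fst S S) (2 * 1) (G (c k)))
        (complexBetti.map (snd S S) (2 * 1) (π₂ (u k)))) +
      (∑ k, cupProduct (rfl : 2 * 1 + 2 * 1 = 2 * 2) (complexBetti.map (fst S S) (2 * 1) (G (c k)))
        (complexBetti.map (snd S S) (2 * 1) (π₃ (u k)))) := by
    rw [← Finset.sum_add_distrib, ← Finset.sum_add_distrib]
    refine Finset.sum_congr rfl fun k _ ↦ ?_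
    conv_lhs => rw [← hsum (u k)]
    simp only [map_add]
  rw [hsplit]
  exact ((isOfHodgeType_sum_cross_projector hS M hcupP hBs hE G hG π₁ π₃ hadj₁ h1 ht₁ ht₃ rfl rfl).add hP
    (isOfHodgeType_sum_cross_projector hS M hcupP hBs hE G hG π₂ π₂ hadj₂ h2 ht₂ ht₂ rfl rfl)).add hP
    (isOfHodgeType_sum_cross_projector hS M hcupP hBs hE G hG π₃ π₁ hadj₃ h3 ht₃ ht₁ rfl rfl)

end TypeTwoTwo

/-! ### The marked K3 surface: projectors, rationality and the action of `Υ_G` -/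

section Marked

variable {S : SchemeOver ℂ} (η : complexBetti S (2 * 1) ≃ₗ[ℂ] (K3Index → ℂ))

/-- **The marked expansion**: `Σₖ (ηy . G⁻¹eₖ) • η⁻¹eₖ = y` — the marked basis `η⁻¹eₖ` and the dual
lattice classes `η⁻¹(G⁻¹eₖ)` are dual families for the cup form read through `η`
(`k3Form_invCol`: `(a . G⁻¹eₖ) = aₖ`). [cite: Huybrechts2016K3, Ch. 14 §0.3 (vi)] -/
theorem sum_k3Form_dual_smul_basis (y : complexBetti S (2 * 1)) :
    ∑ k, k3Form (η y) (η (η.symm fun j => ((k3Gram⁻¹ j k : ℤ) : ℂ))) • η.symm (Pi.single k 1) = y := by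
  simp only [LinearEquiv.apply_symm_apply, k3Form_invCol]
  exact sum_coord_smul_basis η y

/-- **`Υ_G` is of type `(2,2)` for a marked K3 surface.** With period vector `x₀` (`σ = η⁻¹x₀` of type
`(2,0)`, `σ̄ = η⁻¹x̄₀` of type `(0,2)`, `(x₀.x₀) = 0`, `(x₀.x̄₀) ≠ 0`, and the `(1,1)`-classes
containing every class orthogonal to `x₀` and `x̄₀`), the three maps
`π₂₀ x = ((ηx.x̄₀)/(x₀.x̄₀)) σ`, `π₀₂ x = ((ηx.x₀)/(x₀.x̄₀)) σ̄`, `π₁₁ = 1 - π₂₀ - π₀₂` satisfy the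
hypotheses of `isOfHodgeType_sum_cross_of_projectors`. [cite: Huybrechts2016K3, Ch. 6 Prop. 1.2 and Ch. 3 §1.1]
[cite: VoisinHodgeI2002, §11.3.3 Lemma 11.41] -/
theorem isOfHodgeType_sum_cross_K3 (hS : IsSmoothProjective 2 S) (M : HodgeModel 4 (S ⊗ S))
    (hcupP : CupPreservesHodgeType 4 (S ⊗ S)) (x₀ : K3Index → ℂ)
    (hxx : k3Form x₀ x₀ = 0) (hs : k3Form x₀ (star x₀) ≠ 0)
    (h20 : IsOfHodgeType 2 S (2 * 1) 2 0 (η.symm x₀))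
    (h02 : IsOfHodgeType 2 S (2 * 1) 0 2 (η.symm (star x₀)))
    (h11 : ∀ c : complexBetti S (2 * 1), k3Form (η c) x₀ = 0 → k3Form (η c) (star x₀) = 0 →
      IsOfHodgeType 2 S (2 * 1) 1 1 c)
    (G : complexBetti S (2 * 1) →ₗ[ℂ] complexBetti S (2 * 1))
    (hG : ∀ (i j : ℕ) x, IsOfHodgeType 2 S (2 * 1) i j x → IsOfHodgeType 2 S (2 * 1) i j (G x)) :
    IsOfHodgeType 4 (S ⊗ S) (2 * 2) 2 2
      (∑ k, cupProduct (rfl : 2 * 1 + 2 * 1 = 2 * 2)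
        (complexBetti.map (fst S S) (2 * 1) (G (η.symm (Pi.single k 1))))
        (complexBetti.map (snd S S) (2 * 1) (η.symm fun j => ((k3Gram⁻¹ j k : ℤ) : ℂ)))) := by
  set s : ℂ := k3Form x₀ (star x₀) with hs_def
  have hss : k3Form (star x₀) (star x₀) = 0 := by rw [← star_k3Form, hxx, star_zero]
  have hs' : k3Form (star x₀) x₀ = s := k3Form_comm _ _
  -- the projectors
  let f₁ : complexBetti S (2 * 1) →ₗ[ℂ] ℂ := (k3FormC.flip (star x₀)).comp η.toLinearMap
  let f₃ : complexBetti S (2 * 1) →ₗ[ℂ] ℂ := (k3FormC.flip x₀).comp η.toLinearMap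
  let π₁ : complexBetti S (2 * 1) →ₗ[ℂ] complexBetti S (2 * 1) := f₁.smulRight (s⁻¹ • η.symm x₀)
  let π₃ : complexBetti S (2 * 1) →ₗ[ℂ] complexBetti S (2 * 1) := f₃.smulRight (s⁻¹ • η.symm (star x₀))
  let π₂ : complexBetti S (2 * 1) →ₗ[ℂ] complexBetti S (2 * 1) := LinearMap.id - π₁ - π₃
  have hπ₁ : ∀ x, π₁ x = (k3Form (η x) (star x₀) * s⁻¹) • η.symm x₀ := fun x ↦ by
    simp only [π₁, f₁, LinearMap.smulRight_apply, LinearMap.comp_apply, LinearEquiv.coe_coe,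
      LinearMap.BilinForm.flip_apply, k3FormC_apply, smul_smul]
  have hπ₃ : ∀ x, π₃ x = (k3Form (η x) x₀ * s⁻¹) • η.symm (star x₀) := fun x ↦ by
    simp only [π₃, f₃, LinearMap.smulRight_apply, LinearMap.comp_apply, LinearEquiv.coe_coe,
      LinearMap.BilinForm.flip_apply, k3FormC_apply, smul_smul]
  have hπ₂ : ∀ x, π₂ x = x - π₁ x - π₃ x := fun x ↦ rfl
  -- pairings of the projectors
  have hB₁ : ∀ x (z : K3Index → ℂ), k3Form (η (π₁ x)) z = k3Form (η x) (star x₀) * s⁻¹ * k3Form x₀ z :=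
    fun x z ↦ by rw [hπ₁, map_smul, LinearEquiv.apply_symm_apply, k3Form_smul_left]
  have hB₃ : ∀ x (z : K3Index → ℂ), k3Form (η (π₃ x)) z = k3Form (η x) x₀ * s⁻¹ * k3Form (star x₀) z :=
    fun x z ↦ by rw [hπ₃, map_smul, LinearEquiv.apply_symm_apply, k3Form_smul_left]
  have hB₁' : ∀ (z : K3Index → ℂ) x, k3Form z (η (π₁ x)) = k3Form (η x) (star x₀) * s⁻¹ * k3Form x₀ z :=
    fun z x ↦ by rw [k3Form_comm, hB₁]
  have hB₃' : ∀ (z : K3Index → ℂ) x, k3Form z (η (π₃ x)) = k3Form (η x) x₀ * s⁻¹ * k3Form (star x₀) z :=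
    fun z x ↦ by rw [k3Form_comm, hB₃]
  have hB₂ : ∀ x (z : K3Index → ℂ), k3Form (η (π₂ x)) z =
      k3Form (η x) z - k3Form (η (π₁ x)) z - k3Form (η (π₃ x)) z := fun x z ↦ by
    simp only [hπ₂, map_sub, ← k3FormC_apply, LinearMap.sub_apply]
  have hB₂' : ∀ (z : K3Index → ℂ) x, k3Form z (η (π₂ x)) =
      k3Form z (η x) - k3Form z (η (π₁ x)) - k3Form z (η (π₃ x)) := fun z x ↦ by
    simp only [hπ₂, map_sub, ← k3FormC_apply]
  -- idempotency and orthogonality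
  have h1 : ∀ x, π₁ (π₁ x) = π₁ x := fun x ↦ by
    rw [hπ₁ (π₁ x), hB₁, ← hs_def, hπ₁]
    congr 1
    field_simp
  have h3 : ∀ x, π₃ (π₃ x) = π₃ x := fun x ↦ by
    rw [hπ₃ (π₃ x), hB₃, hs', hπ₃]
    congr 1
    field_simp
  have h13 : ∀ x, π₁ (π₃ x) = 0 := fun x ↦ by
    rw [hπ₁ (π₃ x), hB₃, hss, mul_zero, zero_mul, zero_smul]
  have h31 : ∀ x, π₃ (π₁ x) = 0 := fun x ↦ by
    rw [hπ₃ (π₁ x), hB₁, hxx, mul_zero, zero_mul, zero_smul]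
  have h2 : ∀ x, π₂ (π₂ x) = π₂ x := fun x ↦ by
    conv_lhs => rw [hπ₂ (π₂ x)]
    rw [show π₁ (π₂ x) = 0 by rw [hπ₂, map_sub, map_sub, h1, h13, sub_self, zero_sub, neg_zero],
      show π₃ (π₂ x) = 0 by rw [hπ₂, map_sub, map_sub, h31, h3, sub_zero, sub_self], sub_zero, sub_zero]
  -- adjointness
  have hadj₁ : ∀ x y, k3Form (η (π₁ x)) (η y) = k3Form (η x) (η (π₃ y)) := fun x y ↦ by
    rw [hB₁, hB₃', k3Form_comm x₀ (η y), k3Form_comm (star x₀) (η x)]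
    ring
  have hadj₃ : ∀ x y, k3Form (η (π₃ x)) (η y) = k3Form (η x) (η (π₁ y)) := fun x y ↦ by
    rw [hB₃, hB₁', k3Form_comm (star x₀) (η y), k3Form_comm x₀ (η x)]
    ring
  have hadj₂ : ∀ x y, k3Form (η (π₂ x)) (η y) = k3Form (η x) (η (π₂ y)) := fun x y ↦ by
    rw [hB₂, hB₂', hadj₁, hadj₃]
    ring
  -- types
  have ht₁ : ∀ x, IsOfHodgeType 2 S (2 * 1) 2 0 (π₁ x) := fun x ↦ by rw [hπ₁]; exact h20.smul _
  have ht₃ : ∀ x, IsOfHodgeType 2 S (2 * 1) 0 2 (π₃ x) := fun x ↦ by rw [hπ₃]; exact h02.smul _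
  have ht₂ : ∀ x, IsOfHodgeType 2 S (2 * 1) 1 1 (π₂ x) := fun x ↦ by
    refine h11 _ ?_ ?_
    · rw [hB₂, hB₁, hB₃, hxx, hs']
      field_simp
      ring
    · rw [hB₂, hB₁, hB₃, hss]
      field_simp
      ring
  have hsum : ∀ x, π₁ x + π₂ x + π₃ x = x := fun x ↦ by rw [hπ₂]; abel
  exact isOfHodgeType_sum_cross_of_projectors hS M hcupP (B := fun a b ↦ k3Form (η a) (η b))
    (fun a b ↦ k3Form_comm _ _) (sum_k3Form_dual_smul_basis η) G hG π₁ π₂ π₃ hsum h1 h2 h3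
    hadj₁ hadj₂ hadj₃ ht₁ ht₂ ht₃

/-- A finite sum of rational classes is rational (`IsRationalClass.zero/add`). [cite: HatcherAT2002, §3.1] -/
theorem isRationalClass_finset_sum {Y : Type} [TopologicalSpace Y] {k : ℕ} {κ : Type*} (s : Finset κ)
    (f : κ → singularCohomology ℂ ℂ Y k) (hf : ∀ i ∈ s, IsRationalClass (f i)) :
    IsRationalClass (∑ i ∈ s, f i) := by
  classical
  induction s using Finset.induction_on with
  | empty => simpa using IsRationalClass.zero
  | insert a s ha ih =>
    rw [Finset.sum_insert ha]
    exact (hf a (Finset.mem_insert_self a s)).add (ih fun i hi ↦ hf i (Finset.mem_insert_of_mem hi))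

/-- **`Υ_G` is rational** for `G` preserving rational classes: the marked basis `η⁻¹eₖ` and the dual
lattice classes `η⁻¹(G⁻¹eₖ)` are integral (`Λ_{K3}` is unimodular), pull-backs and cup products of
rational classes are rational. [cite: Huybrechts2016K3, Ch. 1 Prop. 3.5 and Ch. 14 §0.3 (vi)]
[cite: HatcherAT2002, §3.1 and §3.2] -/
theorem isRationalClass_sum_cross
    (hint : ∀ c : complexBetti S (2 * 1), IsIntegralClass c ↔ ∃ v : K3Index → ℤ, η c = fun i => (v i : ℂ))
    (G : complexBetti S (2 * 1) →ₗ[ℂ] complexBetti S (2 * 1))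
    (hG_rat : ∀ x, IsRationalClass x → IsRationalClass (G x)) :
    IsRationalClass
      (∑ k, cupProduct (rfl : 2 * 1 + 2 * 1 = 2 * 2)
        (complexBetti.map (fst S S) (2 * 1) (G (η.symm (Pi.single k 1))))
        (complexBetti.map (snd S S) (2 * 1) (η.symm fun j => ((k3Gram⁻¹ j k : ℤ) : ℂ)))) := by
  have hc : ∀ k : K3Index, IsRationalClass (η.symm (Pi.single k 1) : complexBetti S (2 * 1)) := fun k ↦
    ((hint _).2 ⟨Pi.single k 1, by
      rw [LinearEquiv.apply_symm_apply]
      ext i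
      simp only [Pi.single_apply, Int.cast_ite, Int.cast_one, Int.cast_zero]⟩).isRationalClass
  refine isRationalClass_finset_sum _ _ fun k _ ↦ ?_
  exact ((hG_rat _ (hc k)).map (AlgPoints.mapContinuous (L := ℂ) (fst S S))).cup
    (rfl : 2 * 1 + 2 * 1 = 2 * 2)
    ((isRationalClass_invCol η hint k).map (AlgPoints.mapContinuous (L := ℂ) (snd S S)))

/-- **`Υ_G` acts as `c₀ • G`**: granted fibre integration `fst_*(snd^* p) = c₀ • 1_S`,
`fst_*(snd^* x ∪ Υ_G) = c₀ Σₖ (ηx . G⁻¹eₖ) G(η⁻¹eₖ) = c₀ G(Σₖ (ηx)ₖ η⁻¹eₖ) = c₀ G x` (`corr_cross` and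
the marked expansion). [cite: Fulton1998, §16.1] [cite: FultonYoungTableaux1997, Appendix B §B.1 (6)] -/
theorem corr_sum_cross (μ : OrientationFamily) (hS : IsSmoothProjective 2 S) {p : complexBetti S (2 * 2)}
    (hcup : ∀ a b : complexBetti S (2 * 1),
      cupProduct (rfl : 2 * 1 + 2 * 1 = 2 * 2) a b = k3Form (η a) (η b) • p)
    {c₀ : ℂ}
    (hFI : complexGysin μ (IsSmoothProjective.tensor_holds hS hS) hS (fst S S)
        (rfl : 2 * 2 + 2 * 2 = 0 + 2 * (2 + 2)) (complexBetti.map (snd S S) (2 * 2) p) =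
      c₀ • singularCohomology.one ℂ (ComplexPoints S))
    (G : complexBetti S (2 * 1) →ₗ[ℂ] complexBetti S (2 * 1)) (x : complexBetti S (2 * 1)) :
    complexGysin μ (IsSmoothProjective.tensor_holds hS hS) hS (fst S S)
        (rfl : 2 * 1 + 2 * 2 + 2 * 2 = 2 * 1 + 2 * (2 + 2))
        (cupProduct (rfl : 2 * 1 + 2 * 2 = 2 * 1 + 2 * 2) (complexBetti.map (snd S S) (2 * 1) x)
          (∑ k, cupProduct (rfl : 2 * 1 + 2 * 1 = 2 * 2)
            (complexBetti.map (fst S S) (2 * 1) (G (η.symm (Pi.single k 1))))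
            (complexBetti.map (snd S S) (2 * 1) (η.symm fun j => ((k3Gram⁻¹ j k : ℤ) : ℂ))))) =
      c₀ • G x := by
  simp only [map_sum, corr_cross hS hcup μ hFI, mul_smul, ← Finset.smul_sum]
  congr 1
  have h : ∑ k, k3Form (η x) (η (η.symm fun j => ((k3Gram⁻¹ j k : ℤ) : ℂ))) • G (η.symm (Pi.single k 1)) =
      G (∑ k, k3Form (η x) (η (η.symm fun j => ((k3Gram⁻¹ j k : ℤ) : ℂ))) • η.symm (Pi.single k 1)) := by
    simp only [map_sum, map_smul]
  rw [h, sum_k3Form_dual_smul_basis]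

end Marked

end Summit.HodgeConjecture.HodgeConjecture.Theorems.NikulinTwinTransport

end
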